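import Summits.QuantumFields.BalabanUV.Beta.EriceRemainderEnclosureHistoryAutonomyComparisonNonlinearLight

/-!
# EriceRemainderEnclosureHistoryAutonomyComparisonNonlinearVariationPrep — (E121a) THE DAMPING DEFECT OF A STEEP EXCESS IS PRICED BY THE EXCESS VARIATION ALONG THE
# ORBIT.  Base `B u = β₀ + Σ_{k<K} L_k·u_k` (`β₀ > 0`, `L ≥ 0`, `L_0 = 0`; profile, range, sizes ARBITRARY); `B′ ≥ B` with an ISOTONE excess `E = B′ − B` of ANY steepness
# (no modulus of `E`; a modulus of `B′` only for its solution family); solution families `S`, `S′`; base orbit `h = S y`, levels `a_m = 1∕h_m²`, `e_m = E(S′h_m)` (non-increasing),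
# `X_m = B′(S′h_m) − B(S h_m)`; configuration `c` = (`h(c+·)`, `S′(h_c)`) with level gaps `δ_j`.  Within configuration `c`, between depths `k` and `k+1` (`m = c+1+k`), EXACTLY
# `δ_{k+1} − δ_k = X_m − PS′_B − PS′_E` with `PS′_B = B(S′h_m) − B(S′h″_{k+1}) ≤ F(m)·δ_{k+1}` (**`pinSensB_le`**) and `PS′_E = e_m − E(S′h″_{k+1}) ≥ 0`, the two pins
# `h″_{k+1} ≤ h_m` being `δ_{k+1}` apart in level.  THE NEW ROUTE: let `J` be least with `a_{m+J} ≥ a_m + δ_{k+1}`; then `h″_{k+1} ≥ h_{m+J}`, so `PS′_E ≤ e_m − e_{m+J}` (pin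
# monotonicity, isotone excess), while for `j < J` the orbit level `a_{m+j}` is within `δ_{k+1}` of `a_m`.  Hence, GIVEN THE VARIATION BOUND `X_m·h_m² ≥ Σ_{j<J} h_{m+j}²·(e_{m+j} −
# e_{m+j+1})` at the deeper row (it is what the level-gauge induction proves when the excess difference of (E118b) `row_ge` is NOT dropped — sequel (E121c∕d)), the surplus
# `PS′_E − X_m` is at most `Σ_{j<J}(1 − a_m∕a_{m+j})·Δe_{m+j} ≤ e_m·h_m²·δ_{k+1}`:  **`conf_incr_ge_var`** — `δ_k − δ_{k+1} ≤ (F(m) + e_m·h_m²)·δ_k`, the damping defect of (E118a)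
# `conf_incr_ge` with the excess-modulus term `ME·h_m³∕2` replaced by `e_m·h_m²` = EXCESS SIZE × LEVEL⁻¹ — no modulus, no light row.  The companion (E121b)
# `…NonlinearVariationBase` shows that this extra fits the spare twentieth of the damped budget polynomial as soon as `e_m ≤ β₀∕10` (`defect_size_le`) and that deep
# enough along the orbit the variation bound holds for every `J` outright (`var_base`).  The sequels: (E121c) the row inequality with the per-age defect as a HYPOTHESIS,
# (E121d) the generic gauge step KEEPING the excess difference (so the variation bound propagates), (E121e) COMPARISON AT ANY STEEPNESS FOR EVERY ISOTONE EXCESS OF SIZE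
# `≤ β₀∕10` (the dual of (E119d): small size, any modulus — vs. small modulus, any size).

Cell `pub-balaban`, β-function sub-cell, BINDER row D4 «RemainderConst leaves for Bałaban's split» (`HOME/BINDER-OWNERS.md`; owner lineage `b2b-balaban-beta-an4`;
this file by co-owner #2 lineage `b2b-balaban-beta-d4-p2`, generation 99), β-FLOW TEAM duty (1), FREEZE (0) honoured (def-free; imports (E120c); uses (E118a)
`sum_range_eq_Ico_of_zero` ∕ `affine_facts`, (E119b) `excess_facts` ∕ `excess_orbit_antitone`, (E63a) `levelGap_le_pin_gap`, (E48a) `family_mem` ∕ `family_tail_eq` ∕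
`family_zero` ∕ `le_of_pin_le` ∕ `strictAnti_of_memFlow`, node U2's `Sharpness.abs_sub_le_half_cube_mul` BY NAME; `pinSensB_le` is the `B`-part of (E118a) `pinSens_le`;
nothing restated).

HONEST FRAMING (page 1, verbatim and binding).  *"Discharging BetaPertH makes Bałaban's UV stability UNCONDITIONAL — a real constructive-QFT result; it is
NOT the continuum limit and NOT the Clay problem."*  THIS FILE DISCHARGES NOTHING OF THE KIND.  Elementary real analysis about ABSTRACT functionals on a box
]0,γ]^ℕ with displayed floors, moduli, profiles and signs — hypotheses of a census, not facts; the form, signs, ages and moments of Bałaban's (1.22) limit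
functional are NOT PRINTED ([I] p. 298; GAPS G-t4-U2-1∕-2) and NOT asserted.  Row D4 class UNCHANGED (critical-path width 0; instance 0∕1; D4 DISCHARGE NO
DATE).  HONEST DEPENDENCY: continuum YM on T⁴ ⇐ BetaPertH ∧ nine spine estimates (0/9 proved); BetaPertH ⇐ (D1) ∧ (D4) ∧ CAP+tail; G-an2-4 gates asym, D1
and NE2/3/4.  NOT CLAIMED here: the comparison theorem (sequel (E121e)); anything printed — NOT B12 Thm 2, NOT BetaPertH, NOT continuum, NOT Clay.

WHAT IS PROVED ([folklore]; 0 `def`, 0 sorry).  §1 `levels_facts`, **`pinSensB_le`**.  §2 **`conf_incr_ge_var`**.  (§3–§4 `defect_size_le`, `exists_base_depth_var`, `var_base` are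
in the companion (E121b) `…NonlinearVariationBase`.)
-/

noncomputable section
open Finset Set

namespace Summit.QuantumFields.BalabanUV.Beta.EriceRemainderEnclosureHistoryAutonomyComparisonNonlinearVariationPrep

open Literature.MathematicalPhysics.QuantumFieldTheory.Balaban1983to89
open Literature.MathematicalPhysics.QuantumFieldTheory.Balaban1983to89.T4BetaStationary
open Literature.MathematicalPhysics.QuantumFieldTheory.Balaban1983to89.T4BetaFlowWellPosed
open Literature.MathematicalPhysics.QuantumFieldTheory.Balaban1983to89.T4BetaFlowWellPosed.Sharpness (abs_sub_le_half_cube_mul)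
open Summit.QuantumFields.BalabanUV.Beta.EriceRemainderEnclosureHistoryAutonomyOrder
  (family_mem family_tail_eq family_zero le_of_pin_le strictAnti_of_memFlow)
open Summit.QuantumFields.BalabanUV.Beta.EriceRemainderEnclosureHistoryAutonomyComparisonDropBound (levelGap_le_pin_gap)
open Summit.QuantumFields.BalabanUV.Beta.EriceRemainderEnclosureHistoryAutonomyComparisonNonlinearRowPrep (sum_range_eq_Ico_of_zero affine_facts)
open Summit.QuantumFields.BalabanUV.Beta.EriceRemainderEnclosureHistoryAutonomyComparisonNonlinearModulusPrep (excess_facts excess_orbit_antitone)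

variable {B B' : (ℕ → ℝ) → ℝ} {γ β₀ b' M' : ℝ} {L : ℕ → ℝ} {K : ℕ} {S S' : ℝ → ℕ → ℝ}

/-! ## §1 Levels along a box solution; the pin sensitivity of the AFFINE part along the perturbed family -/

/-- Along a box solution of a memory with floor `β₀ > 0`: the levels increase, and by at least `β₀` per scale: `a_i ≤ a_{i+j}` and `a_i + j·β₀ ≤ a_{i+j}`. [folklore] -/
theorem levels_facts {h : ℕ → ℝ} {gIR : ℝ} (hlo : ∀ u, SeqBox γ u → β₀ ≤ B u) (hh : SeqBox γ h) (hf : MemFlow B gIR h) (i j : ℕ) :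
    1 / h i ^ 2 + (j : ℝ) * β₀ ≤ 1 / h (i + j) ^ 2 := by
  induction j with
  | zero => simp
  | succ j ih =>
    rw [show i + (j + 1) = i + j + 1 by ring, hf.2 (i + j)]
    have := hlo _ (seqBox_shift hh (i + j + 1))
    push_cast; linarith

/-- **THE PIN SENSITIVITY OF THE AFFINE PART ALONG THE PERTURBED FAMILY.**  `B` affine as displayed (`L_0 = 0`); `B′` isotone with floor `b′ > 0`, modulus `M′`, unique
solutions; pins `0 < q′ ≤ q ≤ γ` with `q` COMPARED (`S′q ≤ S q` at every scale).  Then `B(S′q) − B(S′q′) ≤ (Σ_{1≤k<K} L_k(S q)_k³∕2)·(1∕q′² − 1∕q²)` (the two `B′`-solutions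
are ordered, (E48a) `le_of_pin_le`; their level gaps never exceed the pin gap, (E63a) `levelGap_le_pin_gap`; coupling gap ≤ cube∕2 × level gap, cubes read on the base
orbit) — the `B`-part of (E118a) `pinSens_le`. [folklore] -/
theorem pinSensB_le (hBaff : ∀ u, SeqBox γ u → B u = β₀ + ∑ k ∈ range K, L k * u k) (hL : ∀ k, 0 ≤ L k) (hL0 : L 0 = 0)
    (hmono' : ∀ u v : ℕ → ℝ, SeqBox γ u → SeqBox γ v → (∀ j, u j ≤ v j) → B' u ≤ B' v) (hb' : 0 < b')
    (hB' : ∀ u u' : ℕ → ℝ, SeqBox γ u → SeqBox γ u' → ∀ D : ℝ, (∀ j, |u j - u' j| ≤ D) → |B' u - B' u'| ≤ M' * D) (hM' : 0 ≤ M')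
    (hlo' : ∀ u, SeqBox γ u → b' ≤ B' u)
    (hS' : ∀ p, 0 < p → p ≤ γ → SeqBox γ (S' p) ∧ MemFlow B' p (S' p))
    (huniq' : ∀ p, 0 < p → p ≤ γ → ∀ u u' : ℕ → ℝ, SeqBox γ u → SeqBox γ u' → MemFlow B' p u → MemFlow B' p u' → u = u')
    {q q' : ℝ} (hq' : 0 < q') (hq'q : q' ≤ q) (hqγ : q ≤ γ) (hcmp : ∀ j, S' q j ≤ S q j) :
    B (S' q) - B (S' q') ≤ (∑ k ∈ Ico 1 K, L k * S q k ^ 3 / 2) * (1 / q' ^ 2 - 1 / q ^ 2) := by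
  have hq : 0 < q := hq'.trans_le hq'q
  have hq'γ : q' ≤ γ := hq'q.trans hqγ
  obtain ⟨hk, hfk⟩ := hS' q hq hqγ
  obtain ⟨hk', hfk'⟩ := hS' q' hq' hq'γ
  set δ : ℝ := 1 / q' ^ 2 - 1 / q ^ 2 with hδ_def
  have hδ0 : 0 ≤ δ := sub_nonneg.mpr (one_div_le_one_div_of_le (pow_pos hq' 2) (pow_le_pow_left₀ hq'.le hq'q 2))
  have hle : ∀ j, S' q' j ≤ S' q j := fun j => le_of_pin_le hb' hB' hM' hlo' huniq' hq' hq'q hqγ hk' hk hfk' hfk j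
  have hlg : ∀ j, 1 / S' q' j ^ 2 - 1 / S' q j ^ 2 ≤ δ := levelGap_le_pin_gap hmono' hk hfk hk' hfk' hle
  have hgap : ∀ j, S' q j - S' q' j ≤ S' q j ^ 3 / 2 * δ := by
    intro j
    have h1 := (hk j).1; have h2 := (hk' j).1
    have hw := abs_sub_le_half_cube_mul h1 h2 le_rfl (hle j)
    have hg0 : 0 ≤ S' q j - S' q' j := by linarith [hle j]
    have hd0 : 0 ≤ 1 / S' q' j ^ 2 - 1 / S' q j ^ 2 :=
      sub_nonneg.mpr (one_div_le_one_div_of_le (pow_pos h2 2) (pow_le_pow_left₀ h2.le (hle j) 2))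
    rw [abs_of_nonneg hg0, abs_sub_comm, abs_of_nonneg hd0] at hw
    exact hw.trans (mul_le_mul_of_nonneg_left (hlg j) (by positivity))
  rw [hBaff _ hk, hBaff _ hk', add_sub_add_left_eq_sub, ← sum_sub_distrib, sum_mul]
  rw [sum_range_eq_Ico_of_zero (f := fun k => L k * S' q k - L k * S' q' k) (by simp [hL0])]
  refine sum_le_sum fun k _ => ?_
  have hc := hcmp k
  have h3 : S' q k ^ 3 ≤ S q k ^ 3 := pow_le_pow_left₀ (hk k).1.le hc 3
  calc L k * S' q k - L k * S' q' k = L k * (S' q k - S' q' k) := by ring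
    _ ≤ L k * (S' q k ^ 3 / 2 * δ) := mul_le_mul_of_nonneg_left (hgap k) (hL k)
    _ ≤ L k * (S q k ^ 3 / 2 * δ) := mul_le_mul_of_nonneg_left (mul_le_mul_of_nonneg_right (by linarith) hδ0) (hL k)
    _ = L k * S q k ^ 3 / 2 * δ := by ring

/-! ## §2 The damping defect priced by the excess variation along the orbit -/

set_option maxHeartbeats 800000 in
/-- **THE DAMPING DEFECT OF A STEEP EXCESS, PRICED BY THE VARIATION OF THE EXCESS ALONG THE ORBIT.**  Base affine (`L_0 = 0`), `B′ ≥ B` with isotone excess and a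
modulus for its family; base orbit `h = S y`, `e_i = (B′ − B)(S′h_i)`, `X_i = B′(S′h_i) − B(S h_i)`; configuration `c` comparing (`S′(h_c)_j ≤ h_{c+j}`), depth `k`,
`m = c+1+k`, comparison from the pin `h_m`, AND THE VARIATION BOUND AT ROW `m`: `Σ_{j<J} h_{m+j}²·(e_{m+j} − e_{m+j+1}) ≤ X_m·h_m²` for every `J`.  Then with
`δ_j = 1∕S′(h_c)_j² − 1∕h_{c+j}²`:  `δ_k − δ_{k+1} ≤ (Σ_{1≤q<K} L_q·h_{m+q}³∕2 + e_m·h_m²)·δ_k`.  PROOF: exactly `δ_{k+1} − δ_k = X_m − PS′_B − PS′_E` (autonomy);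
`PS′_B ≤ F(m)·δ_{k+1}` (`pinSensB_le`); with `J` least such that `a_{m+J} ≥ a_m + δ_{k+1}` the configuration's point is above `h_{m+J}`, so `PS′_E ≤ e_m − e_{m+J} =
Σ_{j<J} Δe_{m+j}` (pin monotonicity, isotone excess), and `(e_m − e_{m+J}) − X_m ≤ Σ_{j<J}(1 − h_{m+j}²∕h_m²)·Δe_{m+j} ≤ h_m²·δ_{k+1}·(e_m − e_{m+J})` since `a_{m+j} − a_m <
δ_{k+1}` for `j < J`. [folklore] -/
theorem conf_incr_ge_var (hBaff : ∀ u, SeqBox γ u → B u = β₀ + ∑ k ∈ range K, L k * u k) (hL : ∀ k, 0 ≤ L k) (hL0 : L 0 = 0) (hβ : 0 < β₀)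
    (hB' : ∀ u u' : ℕ → ℝ, SeqBox γ u → SeqBox γ u' → ∀ D : ℝ, (∀ j, |u j - u' j| ≤ D) → |B' u - B' u'| ≤ M' * D) (hM' : 0 ≤ M')
    (hexc : ∀ u, SeqBox γ u → B u ≤ B' u)
    (hDmono : ∀ u v : ℕ → ℝ, SeqBox γ u → SeqBox γ v → (∀ j, u j ≤ v j) → B' u - B u ≤ B' v - B v)
    (hS : ∀ p, 0 < p → p ≤ γ → SeqBox γ (S p) ∧ MemFlow B p (S p))
    (huniq : ∀ p, 0 < p → p ≤ γ → ∀ u u' : ℕ → ℝ, SeqBox γ u → SeqBox γ u' → MemFlow B p u → MemFlow B p u' → u = u')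
    (hS' : ∀ p, 0 < p → p ≤ γ → SeqBox γ (S' p) ∧ MemFlow B' p (S' p))
    (huniq' : ∀ p, 0 < p → p ≤ γ → ∀ u u' : ℕ → ℝ, SeqBox γ u → SeqBox γ u' → MemFlow B' p u → MemFlow B' p u' → u = u')
    {y : ℝ} (hy : 0 < y) (hyγ : y ≤ γ) (c k : ℕ) (hcmpc : ∀ j, S' (S y c) j ≤ S y (c + j))
    (hcmpm : ∀ j, S' (S y (c + 1 + k)) j ≤ S y (c + 1 + k + j))
    (hV : ∀ J, ∑ j ∈ range J, S y (c + 1 + k + j) ^ 2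
        * ((B' (S' (S y (c + 1 + k + j))) - B (S' (S y (c + 1 + k + j)))) - (B' (S' (S y (c + 1 + k + j + 1))) - B (S' (S y (c + 1 + k + j + 1)))))
        ≤ (B' (S' (S y (c + 1 + k))) - B (S (S y (c + 1 + k)))) * S y (c + 1 + k) ^ 2) :
    (1 / S' (S y c) k ^ 2 - 1 / S y (c + k) ^ 2) - (1 / S' (S y c) (k + 1) ^ 2 - 1 / S y (c + k + 1) ^ 2)
      ≤ (∑ q ∈ Ico 1 K, L q * S y (c + 1 + k + q) ^ 3 / 2
          + (B' (S' (S y (c + 1 + k))) - B (S' (S y (c + 1 + k)))) * S y (c + 1 + k) ^ 2)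
          * (1 / S' (S y c) k ^ 2 - 1 / S y (c + k) ^ 2) := by
  classical
  obtain ⟨hmono', hlo'⟩ := excess_facts hBaff hL hβ hexc hDmono
  obtain ⟨hmono, hlo, _, _⟩ := affine_facts hBaff hL hβ
  have hqc := family_mem hS hy hyγ c
  have hqm := family_mem hS hy hyγ (c + 1 + k)
  have hw := hS' _ hqc.1 hqc.2
  have hwk := family_mem hS' hqc.1 hqc.2 (k + 1)
  have hh := (hS y hy hyγ).1
  have hf := (hS y hy hyγ).2
  have hpos : ∀ j, 0 < S y j := fun j => (hh j).1
  have hanti := (strictAnti_of_memFlow hβ hlo hh hf).antitone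
  -- notation
  set m : ℕ := c + 1 + k with hm_def
  set e : ℕ → ℝ := fun i => B' (S' (S y i)) - B (S' (S y i)) with he_def
  set X : ℝ := B' (S' (S y m)) - B (S (S y m)) with hX_def
  set δk : ℝ := 1 / S' (S y c) k ^ 2 - 1 / S y (c + k) ^ 2 with hδk
  set δ' : ℝ := 1 / S' (S y c) (k + 1) ^ 2 - 1 / S y (c + k + 1) ^ 2 with hδ'
  set F : ℝ := ∑ q ∈ Ico 1 K, L q * S y (m + q) ^ 3 / 2 with hF
  have he0 : ∀ i, 0 ≤ e i := fun i => by simp only [he_def]; linarith [hexc _ (hS' _ (family_mem hS hy hyγ i).1 (family_mem hS hy hyγ i).2).1]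
  have heanti : ∀ i, e (i + 1) ≤ e i := fun i => (excess_orbit_antitone hBaff hL hβ hB' hM' hexc hDmono hS hS' huniq' hy hyγ i).2
  have heanti' : ∀ i j, e (i + j) ≤ e i := by
    intro i j
    induction j with
    | zero => simp
    | succ j ih => rw [show i + (j + 1) = i + j + 1 by ring]; exact (heanti (i + j)).trans ih
  have hF0 : 0 ≤ F := sum_nonneg fun q _ => by have := hL q; have := hpos (m + q); positivity
  have hδk0 : 0 ≤ δk := sub_nonneg.mpr (one_div_le_one_div_of_le (pow_pos (family_mem hS' hqc.1 hqc.2 k).1 2)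
    (pow_le_pow_left₀ (family_mem hS' hqc.1 hqc.2 k).1.le (hcmpc k) 2))
  -- the increment identity: δ′ = δ_k + X − (Φ′(h_m) − Φ′(h″_{k+1}))
  have e1 : 1 / S' (S y c) (k + 1) ^ 2 = 1 / S' (S y c) k ^ 2 + B' (S' (S' (S y c) (k + 1))) := by
    rw [← family_tail_eq hS' huniq' hqc.1 hqc.2 (k + 1), hw.2.2 k]
  have e2 : 1 / S y (c + k + 1) ^ 2 = 1 / S y (c + k) ^ 2 + B (S (S y m)) := by
    rw [hm_def, ← family_tail_eq hS huniq hy hyγ (c + 1 + k), hf.2 (c + k), show c + k + 1 = c + 1 + k by ring]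
  -- the two pins h″_{k+1} ≤ h_m, level gap δ′
  have hq'q : S' (S y c) (k + 1) ≤ S y m := by have := hcmpc (k + 1); rwa [show c + (k + 1) = c + 1 + k by ring] at this
  have hgap' : 1 / S' (S y c) (k + 1) ^ 2 - 1 / S y m ^ 2 = δ' := by rw [hδ', hm_def, show c + 1 + k = c + k + 1 by ring]
  have hδ'0 : 0 ≤ δ' := by
    rw [← hgap']; exact sub_nonneg.mpr (one_div_le_one_div_of_le (pow_pos hwk.1 2) (pow_le_pow_left₀ hwk.1.le hq'q 2))
  -- the B-part of the pin sensitivity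
  have etail : ∀ q, S y (m + q) = S (S y m) q := fun q => congrFun (family_tail_eq hS huniq hy hyγ m) q
  have hcmpm' : ∀ j, S' (S y m) j ≤ S (S y m) j := fun j => by rw [← etail j]; exact hcmpm j
  have hpsB := pinSensB_le hBaff hL hL0 hmono' hβ hB' hM' hlo' hS' huniq' hwk.1 hq'q hqm.2 hcmpm'
  simp only [← etail] at hpsB
  rw [hgap'] at hpsB
  -- the excess part: ẽ ≥ e_{m+J} for the least J with a_{m+J} ≥ a_m + δ′
  have hexJ : ∃ J : ℕ, 1 / S y m ^ 2 + δ' ≤ 1 / S y (m + J) ^ 2 := by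
    obtain ⟨J, hJ⟩ := exists_nat_ge (δ' / β₀)
    refine ⟨J, le_trans ?_ (levels_facts hlo hh hf m J)⟩
    have : δ' ≤ (J : ℝ) * β₀ := by rw [div_le_iff₀ hβ] at hJ; linarith
    linarith
  set J : ℕ := Nat.find hexJ with hJ_def
  have hJ : 1 / S y m ^ 2 + δ' ≤ 1 / S y (m + J) ^ 2 := Nat.find_spec hexJ
  have hJmin : ∀ j, j < J → 1 / S y (m + j) ^ 2 < 1 / S y m ^ 2 + δ' := fun j hj => lt_of_not_ge (Nat.find_min hexJ hj)
  -- h″_{k+1} ≥ h_{m+J}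
  have hzJ := family_mem hS hy hyγ (m + J)
  have hpin : S y (m + J) ≤ S' (S y c) (k + 1) := by
    have h1 : 1 / S' (S y c) (k + 1) ^ 2 ≤ 1 / S y (m + J) ^ 2 := by rw [← hgap'] at hJ; linarith
    have h2 := (one_div_le_one_div (pow_pos hwk.1 2) (pow_pos hzJ.1 2)).mp h1
    exact (pow_le_pow_iff_left₀ hzJ.1.le hwk.1.le two_ne_zero).mp h2
  have hkJ := hS' _ hzJ.1 hzJ.2
  have hkw := hS' _ hwk.1 hwk.2
  have hleJ : ∀ j, S' (S y (m + J)) j ≤ S' (S' (S y c) (k + 1)) j := fun j =>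
    le_of_pin_le hβ hB' hM' hlo' huniq' hzJ.1 hpin hwk.2 hkJ.1 hkw.1 hkJ.2 hkw.2 j
  have hEJ : e (m + J) ≤ B' (S' (S' (S y c) (k + 1))) - B (S' (S' (S y c) (k + 1))) := by
    simp only [he_def]; exact hDmono _ _ hkJ.1 hkw.1 hleJ
  -- telescoping: e_m − e_{m+J} = Σ_{j<J} Δe_{m+j}
  have htel : ∀ J' : ℕ, ∑ j ∈ range J', (e (m + j) - e (m + j + 1)) = e m - e (m + J') := by
    intro J'
    induction J' with
    | zero => simp
    | succ J' ih => rw [sum_range_succ, ih, show m + (J' + 1) = m + J' + 1 by ring]; ring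
  -- the surplus: (e_m − e_{m+J}) − X ≤ h_m² δ′ (e_m − e_{m+J}) ≤ h_m² δ′ e_m
  have hVJ := hV J
  have hm2 : 0 < S y m ^ 2 := pow_pos (hpos m) 2
  have hterm : ∀ j ∈ range J, (S y m ^ 2 - S y (m + j) ^ 2) * (e (m + j) - e (m + j + 1))
      ≤ S y m ^ 2 * (S y m ^ 2 * δ') * (e (m + j) - e (m + j + 1)) := by
    intro j hj
    have hjJ := hJmin j (mem_range.mp hj)
    have hΔ0 : 0 ≤ e (m + j) - e (m + j + 1) := by linarith [heanti (m + j)]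
    refine mul_le_mul_of_nonneg_right ?_ hΔ0
    have hpj := hpos (m + j)
    have hpj2 : 0 < S y (m + j) ^ 2 := pow_pos hpj 2
    -- h_m² − h_{m+j}² = h_m² h_{m+j}² (a_{m+j} − a_m) ≤ h_m² h_{m+j}² δ′ ≤ h_m² h_m² δ′
    have hc1 : S y (m + j) ^ 2 * (1 / S y (m + j) ^ 2) = 1 := mul_one_div_cancel hpj2.ne'
    have hc2 : S y m ^ 2 * (1 / S y m ^ 2) = 1 := mul_one_div_cancel hm2.ne'
    have hid : S y m ^ 2 - S y (m + j) ^ 2 = S y m ^ 2 * S y (m + j) ^ 2 * (1 / S y (m + j) ^ 2 - 1 / S y m ^ 2) := by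
      linear_combination (-(S y m ^ 2)) * hc1 + (S y (m + j) ^ 2) * hc2
    rw [hid]
    have hlt : 1 / S y (m + j) ^ 2 - 1 / S y m ^ 2 ≤ δ' := by linarith
    have hsq : S y (m + j) ^ 2 ≤ S y m ^ 2 := pow_le_pow_left₀ hpj.le (hanti (by omega)) 2
    calc S y m ^ 2 * S y (m + j) ^ 2 * (1 / S y (m + j) ^ 2 - 1 / S y m ^ 2)
        ≤ S y m ^ 2 * S y (m + j) ^ 2 * δ' := mul_le_mul_of_nonneg_left hlt (by positivity)
      _ ≤ S y m ^ 2 * S y m ^ 2 * δ' := mul_le_mul_of_nonneg_right (mul_le_mul_of_nonneg_left hsq hm2.le) hδ'0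
      _ = S y m ^ 2 * (S y m ^ 2 * δ') := by ring
  have hsur : S y m ^ 2 * ((e m - e (m + J)) - X) ≤ S y m ^ 2 * (S y m ^ 2 * δ' * (e m - e (m + J))) := by
    have h1 := sum_le_sum hterm
    have e3 : ∑ j ∈ range J, (S y m ^ 2 - S y (m + j) ^ 2) * (e (m + j) - e (m + j + 1))
        = S y m ^ 2 * ∑ j ∈ range J, (e (m + j) - e (m + j + 1)) - ∑ j ∈ range J, S y (m + j) ^ 2 * (e (m + j) - e (m + j + 1)) := by
      rw [mul_sum, ← sum_sub_distrib]; exact sum_congr rfl fun j _ => by ring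
    have e4 : ∑ j ∈ range J, S y m ^ 2 * (S y m ^ 2 * δ') * (e (m + j) - e (m + j + 1))
        = S y m ^ 2 * (S y m ^ 2 * δ' * ∑ j ∈ range J, (e (m + j) - e (m + j + 1))) := by
      rw [mul_sum, mul_sum]; exact sum_congr rfl fun j _ => by ring
    rw [e3, e4, htel J] at h1
    have hV' : ∑ j ∈ range J, S y (m + j) ^ 2 * (e (m + j) - e (m + j + 1)) ≤ X * S y m ^ 2 := by
      have := hVJ; simp only [he_def, hX_def, hm_def] at this ⊢; exact this
    nlinarith [hV']
  have hsur' : (e m - e (m + J)) - X ≤ S y m ^ 2 * δ' * e m := by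
    have h1 : (e m - e (m + J)) - X ≤ S y m ^ 2 * δ' * (e m - e (m + J)) := le_of_mul_le_mul_left hsur hm2
    have h2 : S y m ^ 2 * δ' * (e m - e (m + J)) ≤ S y m ^ 2 * δ' * e m := by
      apply mul_le_mul_of_nonneg_left _ (by positivity); linarith [he0 (m + J)]
    exact h1.trans h2
  -- assemble: ε = X − PS′_B − PS′_E ≥ −(F + e_m h_m²) δ′
  set θ : ℝ := F + e m * S y m ^ 2 with hθ
  have hθ0 : 0 ≤ θ := add_nonneg hF0 (mul_nonneg (he0 m) hm2.le)
  set ε : ℝ := δ' - δk with hε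
  have key : ε = X - (B (S' (S y m)) - B (S' (S' (S y c) (k + 1))))
      - (e m - (B' (S' (S' (S y c) (k + 1))) - B (S' (S' (S y c) (k + 1))))) := by
    simp only [hε, hδ', hδk, hX_def, he_def]; rw [e1, e2]; ring
  have h1 : -(θ * δ') ≤ ε := by
    rw [key, hθ]
    have hpe : e m - (B' (S' (S' (S y c) (k + 1))) - B (S' (S' (S y c) (k + 1)))) ≤ e m - e (m + J) := by linarith
    nlinarith [hpsB, hsur', hpe, hF0, hδ'0]
  have goal : δk - δ' ≤ θ * δk := by
    have hε' : δ' = δk + ε := by rw [hε]; ring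
    rw [hε'] at h1 ⊢
    by_cases hε0 : 0 ≤ ε
    · nlinarith
    · have hε0 := lt_of_not_ge hε0; nlinarith
  simpa [hθ, hF, hm_def] using goal

end Summit.QuantumFields.BalabanUV.Beta.EriceRemainderEnclosureHistoryAutonomyComparisonNonlinearVariationPrep

end
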